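import Summits.NavierStokesRegularity.NavierStokesRegularity.Theorems.QuantisedSymmetryPolyhedralDssProfileExistsStubBlowupTrace
import Literature.Analysis.FluidPDE.TypeIAncientMild
import Literature.Analysis.FluidPDE.VectorCalculus
import HarnessLib

/-!
# The trace is the weak limit — crux stmt-NavierStokesRegularity-1404
  (`QuantisedSymmetry.PolyhedralDssProfileExists`), line polyhedral_cell, stub stub_traceWeakLimit (N25)

Registered stub `stub_traceWeakLimit` (`--supports stmt-NavierStokesRegularity-1404`): for a Type-I
ancient mild field `V` in the Oseen gauge (`IsTypeIAncientMild C V`) with `HasTypeIDecay C₀ V` and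
its pointwise blow-up-time trace `V₀` off the origin (`V(t, x) → V₀(x)` as `t ↑ 0`, `x ≠ 0`; N18,
`stub_blowupTrace`), the trace is locally integrable, weakly divergence free, and is the weak limit
of the slices: `∫ ⟪V(t), φ⟫ → ∫ ⟪V₀, φ⟫` for every continuous compactly supported `φ`.

Proof sketch (folklore; dominated convergence).
* Bounds: `‖V(t, x)‖ ≤ C₀/(‖x‖ + √(−t)) ≤ C₀ ‖x‖⁻¹` for `t < 0`, `x ≠ 0` (`0 ≤ C₀`,
  `blowupTrace_const_nonneg`), hence `‖V₀ x‖ ≤ C₀ ‖x‖⁻¹` in the limit.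
* Measurability: replacing the (irrelevant) slices `V(t)`, `t ≥ 0`, by `V(−1)`, every slice is
  continuous, and `V(t, x) → V₀(x)` along `𝓝[<] 0` for a.e. `x` (the origin is Lebesgue-null), so
  `V₀` is a.e. strongly measurable (`aestronglyMeasurable_of_tendsto_ae`).
* The envelope `C₀ ‖x‖⁻¹` is locally integrable on `ℝ³` (`‖x‖⁻¹ ∈ L¹(B_r)`,
  `NewtonPotentialHolder.integrableOn_ball_norm_rpow_neg`), whence `V₀ ∈ L¹_loc`.
* Weak convergence: `|⟪V(t, x), φ(x)⟫| ≤ C₀ ‖x‖⁻¹ ‖φ x‖`, an integrable envelope (locally integrable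
  times continuous compactly supported), and dominated convergence along the countably generated
  filter `𝓝[<] 0`.
* Weak solenoidality: `∫ ⟪V(t), ∇θ⟫ = 0` for `t < 0` (smooth divergence-free slices are weakly
  divergence free, `IsTypeIAncientMild.isWeaklyDivFree`), and `∇θ` is continuous with compact
  support, so the identity passes to the limit by uniqueness of limits.
-/

noncomputable section

-- the summit namespace `…NavierStokesRegularity.NavierStokesRegularity…` is the tree convention (D-0017)
set_option linter.dupNamespace false

namespace Summit.NavierStokesRegularity.NavierStokesRegularity.Theorems.PolyhedralDssProfileExists.PolyhedralCell

open MeasureTheory Set Function Filter Topology Metric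
open Literature.Analysis Literature.Analysis.FluidPDE
open scoped InnerProductSpace RealInnerProductSpace

section TraceWeakLimit

variable {V : ℝ → EuclideanSpace ℝ (Fin 3) → EuclideanSpace ℝ (Fin 3)} {C C₀ : ℝ}
  {V₀ : EuclideanSpace ℝ (Fin 3) → EuclideanSpace ℝ (Fin 3)}

/-- The space part of the Type-I bound: `‖V(t, x)‖ ≤ C₀ ‖x‖⁻¹` for `t < 0`, `x ≠ 0`
(drop `√(−t) ≥ 0` in the denominator; `0 ≤ C₀`). -/
theorem traceWeakLimit_norm_slice_le (hD : HasTypeIDecay C₀ V) {t : ℝ} (ht : t < 0)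
    {x : EuclideanSpace ℝ (Fin 3)} (hx : x ≠ 0) : ‖V t x‖ ≤ C₀ * ‖x‖⁻¹ := by
  rw [← div_eq_mul_inv]
  exact (hD t ht x).trans (div_le_div_of_nonneg_left (blowupTrace_const_nonneg hD)
    (norm_pos_iff.2 hx) (le_add_of_nonneg_right (Real.sqrt_nonneg _)))

/-- The Type-I bound of the trace: `‖V₀ x‖ ≤ C₀ ‖x‖⁻¹` for `x ≠ 0` (pass to the limit `t ↑ 0`). -/
theorem traceWeakLimit_norm_trace_le (hD : HasTypeIDecay C₀ V)
    (hT : ∀ x, x ≠ 0 → Tendsto (fun t => V t x) (𝓝[<] 0) (𝓝 (V₀ x)))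
    {x : EuclideanSpace ℝ (Fin 3)} (hx : x ≠ 0) : ‖V₀ x‖ ≤ C₀ * ‖x‖⁻¹ :=
  le_of_tendsto (hT x hx).norm (by
    filter_upwards [self_mem_nhdsWithin] with t ht
    exact traceWeakLimit_norm_slice_le hD ht hx)

/-- The origin is Lebesgue-null in `ℝ³`: a.e. `x ≠ 0`. -/
theorem traceWeakLimit_ae_ne_zero :
    ∀ᵐ x ∂(volume : Measure (EuclideanSpace ℝ (Fin 3))), x ≠ 0 := by
  rw [ae_iff]; simp

/-- **The trace is a.e. strongly measurable**: it is the a.e. limit along `𝓝[<] 0` (countably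
generated, `NeBot`) of continuous slices (the slices at `t ≥ 0`, irrelevant for the limit, are
replaced by the continuous slice `V(−1)`). -/
theorem traceWeakLimit_aestronglyMeasurable (hV : IsTypeIAncientMild C V)
    (hT : ∀ x, x ≠ 0 → Tendsto (fun t => V t x) (𝓝[<] 0) (𝓝 (V₀ x))) :
    AEStronglyMeasurable V₀ volume := by
  classical
  have h1 : (-1 : ℝ) < 0 := by norm_num
  let W : ℝ → EuclideanSpace ℝ (Fin 3) → EuclideanSpace ℝ (Fin 3) :=
    fun t => if t < 0 then V t else V (-1)
  have hWm : ∀ t, AEStronglyMeasurable (W t) volume := fun t => by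
    by_cases ht : t < 0
    · simpa only [W, if_pos ht] using hV.aestronglyMeasurable_slice ht
    · simpa only [W, if_neg ht] using hV.aestronglyMeasurable_slice h1
  refine aestronglyMeasurable_of_tendsto_ae (𝓝[<] (0 : ℝ)) hWm ?_
  filter_upwards [traceWeakLimit_ae_ne_zero] with x hx
  refine (hT x hx).congr' ?_
  filter_upwards [self_mem_nhdsWithin] with t ht
  have ht' : t < 0 := ht
  simp only [W, if_pos ht']

/-- The envelope `C₀ ‖x‖⁻¹` is locally integrable on `ℝ³` (`‖x‖⁻¹ ∈ L¹(B_r)` for every `r`,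
`NewtonPotentialHolder.integrableOn_ball_norm_rpow_neg` with exponent `1 < 3`). -/
theorem traceWeakLimit_locallyIntegrable_envelope (C₀ : ℝ) :
    LocallyIntegrable (fun x : EuclideanSpace ℝ (Fin 3) => C₀ * ‖x‖⁻¹) volume := by
  have hI : ∀ r : ℝ, IntegrableOn (fun x : EuclideanSpace ℝ (Fin 3) => C₀ * ‖x‖⁻¹) (ball 0 r)
      volume := fun r =>
    ((NewtonPotentialHolder.integrableOn_ball_norm_rpow_neg (s := 1) (by norm_num) r).congr_fun
      (fun y _ => Real.rpow_neg_one ‖y‖) measurableSet_ball).const_mul C₀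
  exact fun x => ⟨ball 0 (‖x‖ + 1), isOpen_ball.mem_nhds (mem_ball_zero_iff.2 (lt_add_one _)),
    hI _⟩

/-- **The trace is locally integrable**: it is a.e. strongly measurable and dominated by the
locally integrable envelope `C₀ ‖x‖⁻¹`. -/
theorem traceWeakLimit_locallyIntegrable (hV : IsTypeIAncientMild C V) (hD : HasTypeIDecay C₀ V)
    (hT : ∀ x, x ≠ 0 → Tendsto (fun t => V t x) (𝓝[<] 0) (𝓝 (V₀ x))) :
    LocallyIntegrable V₀ volume := by
  refine (traceWeakLimit_locallyIntegrable_envelope C₀).mono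
    (traceWeakLimit_aestronglyMeasurable hV hT) ?_
  filter_upwards [traceWeakLimit_ae_ne_zero] with x hx
  rw [Real.norm_of_nonneg
    (mul_nonneg (blowupTrace_const_nonneg hD) (inv_nonneg.2 (norm_nonneg _)))]
  exact traceWeakLimit_norm_trace_le hD hT hx

/-- **The slices converge weakly to the trace**: `∫ ⟪V(t), φ⟫ → ∫ ⟪V₀, φ⟫` as `t ↑ 0` for every
continuous compactly supported `φ` (dominated convergence along `𝓝[<] 0` with the integrable
envelope `C₀ ‖x‖⁻¹ ‖φ x‖`). -/
theorem traceWeakLimit_tendsto_integral_inner (hV : IsTypeIAncientMild C V)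
    (hD : HasTypeIDecay C₀ V)
    (hT : ∀ x, x ≠ 0 → Tendsto (fun t => V t x) (𝓝[<] 0) (𝓝 (V₀ x)))
    {φ : EuclideanSpace ℝ (Fin 3) → EuclideanSpace ℝ (Fin 3)} (hφ : Continuous φ)
    (hφc : HasCompactSupport φ) :
    Tendsto (fun t => ∫ x, ⟪V t x, φ x⟫_ℝ) (𝓝[<] 0) (𝓝 (∫ x, ⟪V₀ x, φ x⟫_ℝ)) := by
  refine tendsto_integral_filter_of_dominated_convergence (fun x => C₀ * ‖x‖⁻¹ * ‖φ x‖)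
    ?_ ?_ ?_ ?_
  · filter_upwards [self_mem_nhdsWithin] with t ht
    exact ((hV.continuous_slice ht).inner hφ).aestronglyMeasurable
  · filter_upwards [self_mem_nhdsWithin] with t ht
    filter_upwards [traceWeakLimit_ae_ne_zero] with x hx
    exact (norm_inner_le_norm _ _).trans
      (mul_le_mul_of_nonneg_right (traceWeakLimit_norm_slice_le hD ht hx) (norm_nonneg _))
  · simpa only [smul_eq_mul] using
      (traceWeakLimit_locallyIntegrable_envelope C₀).integrable_smul_right_of_hasCompactSupport
        hφ.norm hφc.norm
  · filter_upwards [traceWeakLimit_ae_ne_zero] with x hx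
    exact (hT x hx).inner tendsto_const_nhds

/-- **The trace is weakly divergence free**: for a test function `θ`, `∫ ⟪V(t), ∇θ⟫ = 0` for every
`t < 0` (`IsTypeIAncientMild.isWeaklyDivFree`), `∇θ` is continuous with compact support, and the
pairings converge to `∫ ⟪V₀, ∇θ⟫` (`traceWeakLimit_tendsto_integral_inner`); uniqueness of limits
along the `NeBot` filter `𝓝[<] 0`. -/
theorem traceWeakLimit_isWeaklyDivFree (hV : IsTypeIAncientMild C V) (hD : HasTypeIDecay C₀ V)
    (hT : ∀ x, x ≠ 0 → Tendsto (fun t => V t x) (𝓝[<] 0) (𝓝 (V₀ x))) :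
    IsWeaklyDivFree V₀ := by
  intro θ hθ
  have hgc : Continuous (gradient θ) :=
    (InnerProductSpace.toDual ℝ (EuclideanSpace ℝ (Fin 3))).symm.continuous.comp
      (hθ.contDiff.continuous_fderiv (by simp))
  have hgs : HasCompactSupport (gradient θ) :=
    (hθ.hasCompactSupport.fderiv (𝕜 := ℝ)).comp_left
      (g := (InnerProductSpace.toDual ℝ (EuclideanSpace ℝ (Fin 3))).symm) (map_zero _)
  have hlim := traceWeakLimit_tendsto_integral_inner hV hD hT hgc hgs
  have hzero : (fun _ : ℝ => (0 : ℝ)) =ᶠ[𝓝[<] (0 : ℝ)]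
      fun t => ∫ x, ⟪V t x, gradient θ x⟫_ℝ := by
    filter_upwards [self_mem_nhdsWithin] with t ht
    exact (hV.isWeaklyDivFree ht θ hθ).symm
  exact tendsto_nhds_unique hlim (tendsto_const_nhds.congr' hzero)

end TraceWeakLimit

/-- **Stub `stub_traceWeakLimit` (N25): the trace is the weak limit, is locally integrable and
weakly solenoidal.** For a Type-I ancient mild field `V` in the Oseen gauge with
`HasTypeIDecay C₀ V` and its pointwise trace `V₀` off the origin (`V(t, x) → V₀(x)`, `t ↑ 0`,
`x ≠ 0`): `V₀ ∈ L¹_loc` (`traceWeakLimit_locallyIntegrable`: a.e. limit of continuous slices,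
dominated by `C₀ ‖x‖⁻¹ ∈ L¹_loc(ℝ³)`), `V₀` is weakly divergence free
(`traceWeakLimit_isWeaklyDivFree`), and `V(t) ⇀ V₀` against continuous compactly supported fields
(`traceWeakLimit_tendsto_integral_inner`, dominated convergence along `𝓝[<] 0`). -/
theorem stub_traceWeakLimit :
    ∀ (V : ℝ → EuclideanSpace ℝ (Fin 3) → EuclideanSpace ℝ (Fin 3)) (C C₀ : ℝ)
      (V₀ : EuclideanSpace ℝ (Fin 3) → EuclideanSpace ℝ (Fin 3)),
      IsTypeIAncientMild C V → HasTypeIDecay C₀ V →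
      (∀ x, x ≠ 0 → Tendsto (fun t => V t x) (𝓝[<] 0) (𝓝 (V₀ x))) →
      LocallyIntegrable V₀ volume ∧ IsWeaklyDivFree V₀ ∧
      (∀ φ : EuclideanSpace ℝ (Fin 3) → EuclideanSpace ℝ (Fin 3), Continuous φ → HasCompactSupport φ →
        Tendsto (fun t => ∫ x, ⟪V t x, φ x⟫_ℝ) (𝓝[<] 0) (𝓝 (∫ x, ⟪V₀ x, φ x⟫_ℝ))) :=
  fun _ _ _ _ hV hD hT =>
    ⟨traceWeakLimit_locallyIntegrable hV hD hT, traceWeakLimit_isWeaklyDivFree hV hD hT,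
      fun _ hφ hφc => traceWeakLimit_tendsto_integral_inner hV hD hT hφ hφc⟩

end Summit.NavierStokesRegularity.NavierStokesRegularity.Theorems.PolyhedralDssProfileExists.PolyhedralCell
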